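import Summits.BirchSwinnertonDyer.BirchSwinnertonDyer.Theorems.ManinLocalTwoThreeNewformSeventyTwoTrace
import Summits.BirchSwinnertonDyer.BirchSwinnertonDyer.Theorems.ManinLocalTwoThreeNewformPinningForty
import HarnessLib

/-!
# Level 72 (`2³·3²`, genus `5`; `4 ∣ 72` AND `9 ∣ 72`), newform part 3: the newform of every `X₀(72)`-datum is
# `φ₇₂ = ⅔·η₄⁴η₆²/η₂² + ⅓·η₂⁴η₁₂²/η₄²` — FACT-FREE newform pinning at the first genus-`5` level, in both crux domains

Cell bsd-f2-manin, route `ManinLocalTwoThree` (cruxes C2 `ManinOddAtFour` stmt-22967, C3 `ManinPrimeToThreeAtNine` stmt-22968), prover seat p2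
gen 27; sequel to `…NewformSeventyTwo` (`h₁ = η₄⁴η₆²/η₂²`, `h₂ = η₂⁴η₁₂²/η₄²`, `h₃ = η₁₂⁴` with `(a₁,a₂,a₃) = (1,0,2), (1,0,−4), (0,1,0)`)
and `…NewformSeventyTwoTrace` (both traces `Tr₃₆ : S₂(Γ₀(72)) → S₂(Γ₀(36))`, `Tr₂₄ : S₂(Γ₀(72)) → S₂(Γ₀(24))` kill `h₁, h₂, h₃`;
`Tr₃₆` kills `f₂₄`).  The device of `NewformPinningForty`, with TWO traces and THREE coefficients:

* §6 `μ(72) = 144`, `ν_∞ = 16`, `ν₂ = ν₃ = 0`, `g(X₀(72)) = 5 = dim S₂(Γ₀(72))`.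
* §7 `T = (Tr₃₆, Tr₂₄)`: `T(ι f₃₆) = (2f₃₆, ·)`, `T(ι f₂₄) = (0, 3f₂₄)` are independent, so `rank T ≥ 2` and `dim ker T ≤ 3`;
  `h₁, h₂, h₃ ∈ ker T` are independent (their `3 × 3` coefficient matrix is invertible), so **`ker T = ℂh₁ ⊕ ℂh₂ ⊕ ℂh₃`**.
* §8 A newform `g` of level `72` lies in `S₂(Γ₀(72))^{new} ⊆ ker T`: `g = αh₁ + βh₂ + γh₃`; `a₁(g) = 1`, `a₂(g) = 0` (`4 ∣ 72`) and
  `a₃(g) = 0` (`9 ∣ 72`) (tree `IsNewform0.cuspCoeff_eq_zero_of_sq_dvd`) give `α + β = 1`, `γ = 0`, `2α − 4β = 0`: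
  **every newform of level `72` is `⅔h₁ + ⅓h₂ = φ₇₂`, so `D.f = φ₇₂` for every `X₀(72)`-datum of every curve** (`f_apply_eq_phi72`).

No definition, no named fact, no sorry, no `U₂`/`U₃` computation.  The remaining half of `|c| = 1` on `X₀(72)` (both C2 and C3 at `72`) is
the `η`-coordinate / Néron-squeeze programme of the genus-`3` files (planner -an §95.11: `x − 1 = η₂η₄/(η₁₈η₃₆)`, `y = η₆²η₁₂²/(η₁₈²η₃₆²)`
for `72a1`).  Nothing here proves C2, C3, Manin's conjecture or BSD. [cite: AtkinLehner1970, Thm. 3, Thm. 5] [cite: DiamondShurman2005, §5.6]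
[cite: CremonaAlgorithms1997, Table 3 (N = 72)]
-/

set_option autoImplicit false
-- lint-debt: the directory name repeats the summit name (sibling precedent `ManinLocalTwoThreeNewformPinningForty.lean`)
set_option linter.dupNamespace false

noncomputable section

open Complex Filter Topology Set Function Asymptotics Polynomial
open UpperHalfPlane hiding I
open scoped Real Topology Manifold MatrixGroups ModularForm
open ModularForm CongruenceSubgroup Matrix.SpecialLinearGroup
open Literature.NumberTheory.ModularForms
open Literature.NumberTheory.EllipticCurves Literature.NumberTheory.EllipticCurves.ModularForms

namespace Summit.BirchSwinnertonDyer.BirchSwinnertonDyer.Theorems.ManinLocalTwoThree.NewformSeventyTwo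

open CuspToolkit
open NewformFortyEight (slash_mapGL)

/-! ## §6 `dim S₂(Γ₀(72)) = g(X₀(72)) = 5` -/

/-- `μ(Γ₀(72)) = 144`, `ν_∞ = 16`, `ν₂ = ν₃ = 0`. [cite: DiamondShurman2005, §3.8] -/
theorem gamma0_data_72 : gamma0Index 72 = 144 ∧ nuInfty 72 = 16 ∧ nu₂ 72 = 0 ∧ nu₃ 72 = 0 :=
  ⟨(gamma0Index_mul (m := 8) (n := 9) (by norm_num)).trans
      (by rw [show (8 : ℕ) = 2 ^ 3 by norm_num, show (9 : ℕ) = 3 ^ 2 by norm_num,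
        gamma0Index_prime_pow (p := 2) (e := 3) Nat.prime_two (by norm_num),
        gamma0Index_prime_pow (p := 3) (e := 2) Nat.prime_three (by norm_num)]; norm_num),
    by decide, by rw [nu₂_eq_card]; decide, by rw [nu₃_eq_card]; decide⟩

/-- `g(X₀(72)) = 5`. [cite: DiamondShurman2005, Thm. 3.1.1] -/
theorem genusX0_seventyTwo : genusX0 72 = 5 := by
  obtain ⟨h1, h2, h3, h4⟩ := gamma0_data_72
  rw [genusX0, h1, h2, h3, h4]

/-- **`dim S₂(Γ₀(72)) = 5`.** [cite: DiamondShurman2005, Thm. 3.5.1] -/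
theorem finrank_cuspForm_two_seventyTwo : Module.finrank ℂ (CuspForm (Gamma0 72) 2) = 5 := by
  have h := finrank_cuspForm_two_eq_genusX0_holds 72
  unfold finrank_cuspForm_two_eq_genusX0 at h
  rw [h, genusX0_seventyTwo]

/-! ## §7 The pair of traces has rank `≥ 2`; its kernel is `ℂh₁ ⊕ ℂh₂ ⊕ ℂh₃` -/

/-- **`Tr₃₆(ι f₃₆) = 2·f₃₆`** (`f₃₆ = η₆⁴` viewed at level `72`; `W₃₆ ∈ Γ₀(36)`). [cite: DiamondShurman2005, §5.6] -/
theorem adjDegeneracyMap0_thirtySix_iota_f36 :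
    adjDegeneracyMap0 72 36 1 2 (degeneracyMap0 36 72 1 2 cuspFormEtaProductThirtySix) = (2 : ℂ) • cuspFormEtaProductThirtySix := by
  haveI : Fact (Nat.Prime 2) := ⟨Nat.prime_two⟩
  have hι := coe_degeneracyMap0_one 36 72 2 (by norm_num) cuspFormEtaProductThirtySix
  have h := coe_adjDegeneracyMap0_one_eq_sum 2 2 36 72 (by norm_num) (by norm_num) (degeneracyMap0 36 72 1 2 cuspFormEtaProductThirtySix)
  apply DFunLike.ext
  intro τ
  have hτ := congr_fun h τ
  rw [Finset.sum_apply, Fin.sum_univ_two, hι] at hτ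
  rw [CuspForm.IsGLPos.smul_apply, smul_eq_mul, hτ]
  have h0 : (Matrix.SpecialLinearGroup.transpose (ModularGroup.T ^ ((36 : ℕ) * (((0 : Fin 2) : ℕ) : ℤ) : ℤ)) : SL(2, ℤ)) = 1 := by
    ext i j
    fin_cases i <;> fin_cases j <;> simp [Matrix.SpecialLinearGroup.transpose]
  set X : SL(2, ℤ) := Matrix.SpecialLinearGroup.transpose (ModularGroup.T ^ ((36 : ℕ) * (((1 : Fin 2) : ℕ) : ℤ) : ℤ)) with hX
  have hX' : ∀ i j : Fin 2, X i j = !![(1 : ℤ), 0; 36, 1] i j := by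
    intro i j
    rw [hX]
    fin_cases i <;> fin_cases j <;> simp [Matrix.SpecialLinearGroup.transpose, ModularGroup.coe_T_zpow]
  have hW : (⇑cuspFormEtaProductThirtySix ∣[(2 : ℤ)] (Matrix.SpecialLinearGroup.mapGL ℝ X : GL (Fin 2) ℝ)) = ⇑cuspFormEtaProductThirtySix :=
    SlashInvariantForm.slash_action_eqn cuspFormEtaProductThirtySix _ ⟨X, mem_Gamma0_of_entry X (by simpa using hX' 1 0) ⟨1, by norm_num⟩, rfl⟩
  rw [h0, map_one, SlashAction.slash_one, hW]
  ring

/-- **`Tr₂₄(ι f₂₄) = 3·f₂₄`** (`f₂₄ = η₂η₄η₆η₁₂` viewed at level `72`; `W₂₄, W₄₈ ∈ Γ₀(24)`). [cite: DiamondShurman2005, §5.6] -/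
theorem adjDegeneracyMap0_twentyFour_iota_f24 :
    adjDegeneracyMap0 72 24 1 2 (degeneracyMap0 24 72 1 2 cuspFormEta24) = (3 : ℂ) • cuspFormEta24 := by
  haveI : Fact (Nat.Prime 3) := ⟨Nat.prime_three⟩
  have hι := coe_degeneracyMap0_one 24 72 2 (by norm_num) cuspFormEta24
  have h := coe_adjDegeneracyMap0_one_eq_sum 2 3 24 72 (by norm_num) (by norm_num) (degeneracyMap0 24 72 1 2 cuspFormEta24)
  apply DFunLike.ext
  intro τ
  have hτ := congr_fun h τ
  rw [Finset.sum_apply, Fin.sum_univ_three, hι] at hτ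
  rw [CuspForm.IsGLPos.smul_apply, smul_eq_mul, hτ]
  have h0 : (Matrix.SpecialLinearGroup.transpose (ModularGroup.T ^ ((24 : ℕ) * (((0 : Fin 3) : ℕ) : ℤ) : ℤ)) : SL(2, ℤ)) = 1 := by
    ext i j
    fin_cases i <;> fin_cases j <;> simp [Matrix.SpecialLinearGroup.transpose]
  set X : SL(2, ℤ) := Matrix.SpecialLinearGroup.transpose (ModularGroup.T ^ ((24 : ℕ) * (((1 : Fin 3) : ℕ) : ℤ) : ℤ)) with hX
  set Y : SL(2, ℤ) := Matrix.SpecialLinearGroup.transpose (ModularGroup.T ^ ((24 : ℕ) * (((2 : Fin 3) : ℕ) : ℤ) : ℤ)) with hY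
  have hX' : ∀ i j : Fin 2, X i j = !![(1 : ℤ), 0; 24, 1] i j := by
    intro i j
    rw [hX]
    fin_cases i <;> fin_cases j <;> simp [Matrix.SpecialLinearGroup.transpose, ModularGroup.coe_T_zpow]
  have hY' : ∀ i j : Fin 2, Y i j = !![(1 : ℤ), 0; 48, 1] i j := by
    intro i j
    rw [hY]
    fin_cases i <;> fin_cases j <;> simp [Matrix.SpecialLinearGroup.transpose, ModularGroup.coe_T_zpow]
  have hWX : (⇑cuspFormEta24 ∣[(2 : ℤ)] (Matrix.SpecialLinearGroup.mapGL ℝ X : GL (Fin 2) ℝ)) = ⇑cuspFormEta24 :=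
    SlashInvariantForm.slash_action_eqn cuspFormEta24 _ ⟨X, mem_Gamma0_of_entry X (by simpa using hX' 1 0) ⟨1, by norm_num⟩, rfl⟩
  have hWY : (⇑cuspFormEta24 ∣[(2 : ℤ)] (Matrix.SpecialLinearGroup.mapGL ℝ Y : GL (Fin 2) ℝ)) = ⇑cuspFormEta24 :=
    SlashInvariantForm.slash_action_eqn cuspFormEta24 _ ⟨Y, mem_Gamma0_of_entry Y (by simpa using hY' 1 0) ⟨2, by norm_num⟩, rfl⟩
  rw [h0, map_one, SlashAction.slash_one, hWX, hWY]
  ring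

/-- `Tr₃₆(ι f₂₄) = 0` (the function of `ι f₂₄` is `η₂η₄η₆η₁₂`, negated by `W₃₆`). [cite: DiamondShurman2005, §5.1] -/
theorem adjDegeneracyMap0_thirtySix_iota_f24 : adjDegeneracyMap0 72 36 1 2 (degeneracyMap0 24 72 1 2 cuspFormEta24) = 0 := by
  refine adjDegeneracyMap0_thirtySix_f24 _ ?_
  rw [coe_degeneracyMap0_one 24 72 2 (by norm_num) cuspFormEta24]
  funext τ
  rw [show (cuspFormEta24 τ : ℂ) = etaQuotient 24 (expFn etaList24) τ from rfl,
    etaQuotient_eq_of_dvd_of_support (by norm_num : 24 ∣ 72) (by norm_num) etaList24 (by decide) τ]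

/-- **`dim ker(Tr₃₆, Tr₂₄) ≤ 3`**: the images `(2f₃₆, ·)` of `ι f₃₆` and `(0, 3f₂₄)` of `ι f₂₄` are independent, so the rank is `≥ 2`
in the `5`-dimensional `S₂(Γ₀(72))`. [cite: AtkinLehner1970, Thm. 5] -/
theorem finrank_ker_traces_le_three :
    Module.finrank ℂ (LinearMap.ker ((adjDegeneracyMap0 72 36 1 2).prod (adjDegeneracyMap0 72 24 1 2))) ≤ 3 := by
  haveI : FiniteDimensional ℂ (CuspForm (Gamma0 72) 2) := finiteDimensional_cuspForm_gamma0 72 2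
  haveI : FiniteDimensional ℂ (CuspForm (Gamma0 36) 2) := finiteDimensional_cuspForm_gamma0 36 2
  haveI : FiniteDimensional ℂ (CuspForm (Gamma0 24) 2) := finiteDimensional_cuspForm_gamma0 24 2
  set T := (adjDegeneracyMap0 72 36 1 2).prod (adjDegeneracyMap0 72 24 1 2) with hT
  have hsum := LinearMap.finrank_range_add_finrank_ker T
  rw [finrank_cuspForm_two_seventyTwo] at hsum
  -- two independent vectors in the range
  have hB : T (degeneracyMap0 36 72 1 2 cuspFormEtaProductThirtySix)
      = ((2 : ℂ) • cuspFormEtaProductThirtySix, adjDegeneracyMap0 72 24 1 2 (degeneracyMap0 36 72 1 2 cuspFormEtaProductThirtySix)) := by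
    rw [hT]
    exact Prod.ext adjDegeneracyMap0_thirtySix_iota_f36 rfl
  have hA : T (degeneracyMap0 24 72 1 2 cuspFormEta24) = (0, (3 : ℂ) • cuspFormEta24) := by
    rw [hT]
    exact Prod.ext adjDegeneracyMap0_thirtySix_iota_f24 adjDegeneracyMap0_twentyFour_iota_f24
  have hli0 : LinearIndependent ℂ ![T (degeneracyMap0 36 72 1 2 cuspFormEtaProductThirtySix), T (degeneracyMap0 24 72 1 2 cuspFormEta24)] := by
    rw [LinearIndependent.pair_iff]
    intro s t hst
    rw [hB, hA, Prod.smul_mk, Prod.smul_mk, Prod.mk_add_mk, smul_zero, add_zero, Prod.mk_eq_zero] at hst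
    obtain ⟨h1, h2⟩ := hst
    have hs : s = 0 := by
      rw [smul_smul] at h1
      rcases smul_eq_zero.mp h1 with h | h
      · simpa using h
      · exact absurd h cuspFormEtaProductThirtySix_ne_zero
    refine ⟨hs, ?_⟩
    rw [hs, zero_smul, zero_add, smul_smul] at h2
    rcases smul_eq_zero.mp h2 with h | h
    · simpa using h
    · exact absurd h EtaIdentityReductionTwentyFour.cuspFormEta24_ne_zero
  have hli : LinearIndependent ℂ ![(⟨T (degeneracyMap0 36 72 1 2 cuspFormEtaProductThirtySix), LinearMap.mem_range_self _ _⟩ : LinearMap.range T),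
      ⟨T (degeneracyMap0 24 72 1 2 cuspFormEta24), LinearMap.mem_range_self _ _⟩] := by
    refine LinearIndependent.of_comp (LinearMap.range T).subtype ?_
    convert hli0 using 1
    funext i
    fin_cases i <;> rfl
  have h2 : 2 ≤ Module.finrank ℂ (LinearMap.range T) := by simpa using hli.fintype_card_le_finrank
  omega

section H

variable (H₁ H₂ H₃ : CuspForm (Gamma0 72) 2)
  (hH₁ : ⇑H₁ = etaQuotient 72 (expFn [(2, -2), (4, 4), (6, 2)]))
  (hH₂ : ⇑H₂ = etaQuotient 72 (expFn [(2, 4), (4, -2), (12, 2)]))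
  (hH₃ : ⇑H₃ = etaQuotient 72 (expFn [(12, 4)]))
include hH₁ hH₂ hH₃

/-- `aₙ(αh₁ + βh₂ + γh₃)` for `n = 1, 2, 3`. [folklore] -/
theorem cuspCoeff_combination (α β γ : ℂ) :
    cuspCoeff (α • H₁ + β • H₂ + γ • H₃) 1 = α + β ∧ cuspCoeff (α • H₁ + β • H₂ + γ • H₃) 2 = γ ∧
      cuspCoeff (α • H₁ + β • H₂ + γ • H₃) 3 = 2 * α - 4 * β := by
  have hΓ := one_mem_strictPeriods_coe_gamma0 72
  obtain ⟨a1, a2, a3⟩ := cuspCoeff_h1 H₁ hH₁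
  obtain ⟨b1, b2, b3⟩ := cuspCoeff_h2 H₂ hH₂
  obtain ⟨c1, c2, c3⟩ := cuspCoeff_h3 H₃ hH₃
  refine ⟨?_, ?_, ?_⟩ <;>
    rw [cuspCoeff_add_form hΓ, cuspCoeff_add_form hΓ, cuspCoeff_smul, cuspCoeff_smul, cuspCoeff_smul]
  · rw [a1, b1, c1]; ring
  · rw [a2, b2, c2]; ring
  · rw [a3, b3, c3]; ring

/-- **`h₁, h₂, h₃` are linearly independent** (their coefficient matrix at `n = 1, 2, 3` is invertible). [folklore] -/
theorem linearIndependent_h : LinearIndependent ℂ ![H₁, H₂, H₃] := by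
  rw [Fintype.linearIndependent_iff]
  intro g hg
  rw [Fin.sum_univ_three] at hg
  simp only [Matrix.cons_val_zero, Matrix.cons_val_one, Matrix.cons_val] at hg
  obtain ⟨e1, e2, e3⟩ := cuspCoeff_combination H₁ H₂ H₃ hH₁ hH₂ hH₃ (g 0) (g 1) (g 2)
  rw [hg, cuspCoeff, CuspForm.coe_zero, UpperHalfPlane.qExpansion_zero, map_zero] at e1 e2 e3
  have h0 : g 0 = 0 := by linear_combination (-(2 : ℂ) / 3) * e1 - (1 / 6 : ℂ) * e3
  have h1 : g 1 = 0 := by linear_combination (-(1 : ℂ) / 3) * e1 + (1 / 6 : ℂ) * e3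
  intro i
  fin_cases i
  · exact h0
  · exact h1
  · exact e2.symm

/-- **Every `g` killed by both traces is `αh₁ + βh₂ + γh₃`.** [cite: AtkinLehner1970, Thm. 5] -/
theorem exists_eq_combination_of_traces_eq_zero {g : CuspForm (Gamma0 72) 2}
    (hg36 : adjDegeneracyMap0 72 36 1 2 g = 0) (hg24 : adjDegeneracyMap0 72 24 1 2 g = 0) :
    ∃ α β γ : ℂ, α • H₁ + β • H₂ + γ • H₃ = g := by
  haveI : FiniteDimensional ℂ (CuspForm (Gamma0 72) 2) := finiteDimensional_cuspForm_gamma0 72 2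
  have hmemK : ∀ f : CuspForm (Gamma0 72) 2, adjDegeneracyMap0 72 36 1 2 f = 0 → adjDegeneracyMap0 72 24 1 2 f = 0 →
      f ∈ LinearMap.ker ((adjDegeneracyMap0 72 36 1 2).prod (adjDegeneracyMap0 72 24 1 2)) := fun f h1 h2 ↦ by
    rw [LinearMap.mem_ker]
    exact Prod.ext h1 h2
  have hnot : ¬ LinearIndependent ℂ (Fin.cons g ![H₁, H₂, H₃] : Fin 4 → CuspForm (Gamma0 72) 2) := by
    intro hli
    have h4 : Module.finrank ℂ (Submodule.span ℂ (Set.range (Fin.cons g ![H₁, H₂, H₃] : Fin 4 → CuspForm (Gamma0 72) 2))) = 4 := by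
      rw [finrank_span_eq_card hli, Fintype.card_fin]
    have hle : Submodule.span ℂ (Set.range (Fin.cons g ![H₁, H₂, H₃] : Fin 4 → CuspForm (Gamma0 72) 2))
        ≤ LinearMap.ker ((adjDegeneracyMap0 72 36 1 2).prod (adjDegeneracyMap0 72 24 1 2)) := by
      rw [Submodule.span_le]
      rintro _ ⟨i, rfl⟩
      rw [SetLike.mem_coe]
      fin_cases i
      · exact hmemK g hg36 hg24
      · exact hmemK H₁ (traces_h1 H₁ hH₁).1 (traces_h1 H₁ hH₁).2
      · exact hmemK H₂ (traces_h2 H₂ hH₂).1 (traces_h2 H₂ hH₂).2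
      · exact hmemK H₃ (traces_h3 H₃ hH₃).1 (traces_h3 H₃ hH₃).2
    have hmono := Submodule.finrank_mono hle
    have h3 := finrank_ker_traces_le_three
    omega
  rw [linearIndependent_finCons, not_and, not_not] at hnot
  have hmem : g ∈ Submodule.span ℂ (Set.range ![H₁, H₂, H₃]) := hnot (linearIndependent_h H₁ H₂ H₃ hH₁ hH₂ hH₃)
  obtain ⟨c, hc⟩ := (Submodule.mem_span_range_iff_exists_fun ℂ).mp hmem
  refine ⟨c 0, c 1, c 2, ?_⟩
  rw [Fin.sum_univ_three] at hc
  simpa using hc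

/-! ## §8 Newform pinning at level `72` -/

/-- **Every newform of weight `2` on `Γ₀(72)` is `⅔h₁ + ⅓h₂`** — FACT-FREE (`g ∈ new ⊆ ker Tr₃₆ ∩ ker Tr₂₄`, `a₁ = 1`, `a₂ = 0` as
`4 ∣ 72`, `a₃ = 0` as `9 ∣ 72`). [cite: CremonaAlgorithms1997, Table 3 (N = 72)] -/
theorem eq_phi72_of_isNewform0 {g : CuspForm (Gamma0 72) 2} (hg : IsNewform0 g) : g = (2 / 3 : ℂ) • H₁ + (1 / 3 : ℂ) • H₂ := by
  have hker36 : adjDegeneracyMap0 72 36 1 2 g = 0 :=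
    LinearMap.mem_ker.mp ((Submodule.mem_iInf _).mp hg.1 ⟨(36, 1), by decide, by decide⟩)
  have hker24 : adjDegeneracyMap0 72 24 1 2 g = 0 :=
    LinearMap.mem_ker.mp ((Submodule.mem_iInf _).mp hg.1 ⟨(24, 1), by decide, by decide⟩)
  obtain ⟨α, β, γ, hαβγ⟩ := exists_eq_combination_of_traces_eq_zero H₁ H₂ H₃ hH₁ hH₂ hH₃ hker36 hker24
  have h1 : cuspCoeff g 1 = 1 := hg.2.2
  have h2 : cuspCoeff g 2 = 0 := hg.cuspCoeff_eq_zero_of_sq_dvd Nat.prime_two ⟨18, by norm_num⟩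
  have h3 : cuspCoeff g 3 = 0 := hg.cuspCoeff_eq_zero_of_sq_dvd Nat.prime_three ⟨8, by norm_num⟩
  obtain ⟨e1, e2, e3⟩ := cuspCoeff_combination H₁ H₂ H₃ hH₁ hH₂ hH₃ α β γ
  rw [hαβγ] at e1 e2 e3
  rw [h1] at e1
  rw [h2] at e2
  rw [h3] at e3
  have hα : α = 2 / 3 := by linear_combination (-(2 : ℂ) / 3) * e1 - (1 / 6 : ℂ) * e3
  have hβ : β = 1 / 3 := by linear_combination (-(1 : ℂ) / 3) * e1 + (1 / 6 : ℂ) * e3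
  rw [← hαβγ, hα, hβ, ← e2, zero_smul, add_zero]

omit hH₃ in
/-- **Every `X₀(72)`-datum of every curve has newform `⅔h₁ + ⅓h₂`** (as cusp forms). FACT-FREE. [cite: CremonaAlgorithms1997, Table 3 (N = 72)] -/
theorem f_eq_phi72 {W : WeierstrassCurve ℚ} (D : ModularParametrizationData W 72) : D.f = (2 / 3 : ℂ) • H₁ + (1 / 3 : ℂ) • H₂ := by
  obtain ⟨H₃', hH₃'⟩ := exists_cuspForm_h3
  exact eq_phi72_of_isNewform0 H₁ H₂ H₃' hH₁ hH₂ hH₃' D.isNewformOf.1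

end H

/-- **Every `X₀(72)`-datum of every curve has newform `φ₇₂ = ⅔·η₄⁴η₆²/η₂² + ⅓·η₂⁴η₁₂²/η₄²`** (pointwise, definition-free form).
FACT-FREE; the level `72` lies in BOTH crux domains (`4 ∣ 72`, `9 ∣ 72`). [cite: CremonaAlgorithms1997, Table 3 (N = 72)] -/
theorem f_apply_eq_phi72 {W : WeierstrassCurve ℚ} (D : ModularParametrizationData W 72) :
    ⇑D.f = fun τ ↦ (2 / 3 : ℂ) * etaQuotient 72 (expFn [(2, -2), (4, 4), (6, 2)]) τ
      + (1 / 3 : ℂ) * etaQuotient 72 (expFn [(2, 4), (4, -2), (12, 2)]) τ := by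
  obtain ⟨H₁, hH₁⟩ := exists_cuspForm_h1
  obtain ⟨H₂, hH₂⟩ := exists_cuspForm_h2
  rw [f_eq_phi72 H₁ H₂ hH₁ hH₂ D]
  funext τ
  rw [CuspForm.add_apply, CuspForm.IsGLPos.smul_apply, CuspForm.IsGLPos.smul_apply, smul_eq_mul, smul_eq_mul, hH₁, hH₂]

/-- **Non-emptiness transfer**: if some curve has an `X₀(72)`-datum then `⅔h₁ + ⅓h₂ ∈ S₂(Γ₀(72))^{new}`. [cite: AtkinLehner1970, Thm. 5] -/
theorem mem_newSubspace0_of_datum (H₁ H₂ : CuspForm (Gamma0 72) 2)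
    (hH₁ : ⇑H₁ = etaQuotient 72 (expFn [(2, -2), (4, 4), (6, 2)])) (hH₂ : ⇑H₂ = etaQuotient 72 (expFn [(2, 4), (4, -2), (12, 2)]))
    {W : WeierstrassCurve ℚ} (D : ModularParametrizationData W 72) : (2 / 3 : ℂ) • H₁ + (1 / 3 : ℂ) • H₂ ∈ newSubspace0 72 2 := by
  rw [← f_eq_phi72 H₁ H₂ hH₁ hH₂ D]
  exact D.isNewformOf.1.1

/-- `2² ∣ 72` and `3² ∣ 72`: the level `72` lies in both crux domains. [folklore] -/
theorem sq_dvd_seventyTwo : 2 ^ 2 ∣ 72 ∧ 3 ^ 2 ∣ 72 := ⟨⟨18, by norm_num⟩, ⟨8, by norm_num⟩⟩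

end Summit.BirchSwinnertonDyer.BirchSwinnertonDyer.Theorems.ManinLocalTwoThree.NewformSeventyTwo

end
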